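import Literature.Analysis.SpecialFunctions.LegendrePolynomials
import Literature.Probability.LatticeModels.PlanarIsingWuDiag
import Mathlib.Analysis.SpecialFunctions.Trigonometric.Chebyshev.Basic
import HarnessLib

/-!
# Chelkak–Hongler–Mahfouf's explicit Legendre spinor for the critical diagonal correlations

Towards the exact-solution input of `Literature.Probability.LatticeModels.wu_rhoCHI` along the
route of D. Chelkak, C. Hongler, R. Mahfouf, *Magnetization in the zig-zag layered Ising model and
orthogonal polynomials*, Ann. Inst. Fourier 74 (2024) = arXiv:1904.09168, Appendix §6 (CHM). There
Wu's formula `D_n = (2/π)^n ∏_{k<n}(1 - 1/(4k²))^{k-n}` for the critical full-plane diagonal correlation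
`D_n = 𝔼[σ_{(-n+½,0)} σ_{(n+½,0)}]` is obtained from the Kadanoff–Ceva spinor `V = X_{[𝐯,𝐮]}` on the
double cover of the `π/4`-rotated grid branching over `𝐯 = (-n-½, 0)`, `𝐮 = (n+½, 0)`: `V` is bounded,
discrete harmonic for the four-term Laplacian
`[ΔV](k,s) = -V(k,s) + ¼[V(k-1,s-1) + V(k+1,s-1) + V(k-1,s+1) + V(k+1,s+1)]` except at `(±n, 0)`,
with `V(±n,0) = D_n` (CHM (6.1)) and `[ΔV](±n,0) = -½ D_{n+1}` (`n ≥ 1`), `[ΔV](0,0) = -D_1` (`n = 0`)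
(CHM (6.2)); by uniqueness `V` equals the explicit kernel of CHM Lemma 6.2,
`V(k, ±s) = (C_n/2π) ∫_{-π}^{π} e^{-ikt} y(t)^s P_n(cos t) dt`, `y(t) = (1 - |sin t|)/cos t`,
and CHM Thm 6.3 ("Wu") follows from `‖P_n‖² = 2/(2n+1)`.

This file PROVES the *analytic* content of CHM Lemma 6.2 and of the proof of Thm 6.3, for the real
form of the kernel (the integral above is real: its integrand has odd imaginary part),

  `legendreKernel n k s = (1/2π) ∫_{-π}^{π} cos(kt) y(t)^s P_n(cos t) dt`,  `y = chmY`,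

namely:

* `chmY` and its algebra: `y = cos t/(1 + |sin t|) = (1 - |sin t|)/cos t`, `|y| ≤ 1`,
  `cos t · y = 1 - |sin t|`, **`y = ½ cos t (1 + y²)`** (CHM, proof of Lemma 6.2, second bullet);
* `abs_legendreKernel_le` — boundedness uniformly in `(k, s)` (first bullet);
* `legendreKernel_harmonic` — `K(k,s) = ¼ Σ K(k±1, s±1)` for `s ≥ 1` (second bullet);
* `legendreKernel_row` — the displayed computation
  `K(k,0) - ½[K(k-1,1) + K(k+1,1)] = (1/2π)∫ cos(kt)|sin t| P_n(cos t) dt = (1/π) ∫_{-1}^1 T_k P_n`,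
  hence `= 0` for `|k| < n` (`legendreKernel_row_eq_zero`, by the orthogonality
  `Literature.Analysis.SpecialFunctions.integral_chebyshevT_mul_legendre_eq_zero`) and
  `= (1/π)(2^{n-1}/p_n)(2/(2n+1))` at `k = n` (`legendreKernel_row_self`; `k = -n` by the evenness
  `legendreKernel_neg`);
* `legendreKernel_zero_of_lt` — `K(k,0) = 0` for `|k| > n` (third bullet) and
  `legendreKernel_self` — `K(n,0) = 2^{-n} p_n` ("`D_n = C_n 2^{-n} p_n`"), through the Fourier
  coefficients `(1/2π)∫ cos(kt) cos^m t dt` (`cosPowCoeff`: `= 0` for `|k| > m`, `= 2^{-m}` at `k = m`);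
* `chm_wu_recurrence` — **the assembly of CHM Thm 6.3**: if numbers `D_n` (`D_0 = 1`) and constants
  `C_n` satisfy CHM (6.1)–(6.2) for `V_n = C_n · K_n`, then `D_{n+1} = ρ_n D_n` with
  `ρ_n = 2^{2n+1}/(π(2n+1)p_n²) = wuRatio n`, hence `D_n = wuDiag n` (`chm_wu_formula`).

What is NOT here (the probabilistic half of CHM's appendix, a theory of its own): the Kadanoff–Ceva
fermion and its propagation equation, the infinite-volume limit and the boundary values (6.1)–(6.2),
and the uniqueness of bounded harmonic spinors (optional stopping). With those, `chm_wu_formula` and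
`wu_rhoCHI_of_twoPointPlus_diag_eq` (`PlanarIsingWuDiag.lean`) discharge `wu_rhoCHI`.

## References

* D. Chelkak, C. Hongler, R. Mahfouf, Ann. Inst. Fourier 74 (2024) 2275–2330 = arXiv:1904.09168,
  Appendix §6: (6.1), (6.2), Lemma 6.2, Thm 6.3. [ChelkakHonglerMahfouf2024]
* G. E. Andrews, R. Askey, R. Roy, *Special Functions*, CUP 1999, (2.5.14). [AndrewsAskeyRoy1999]
-/

noncomputable section

open Polynomial intervalIntegral MeasureTheory Finset Real
open Literature.Analysis.SpecialFunctions
open scoped Nat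

namespace Literature.Probability.LatticeModels

/-! ### CHM's function `y(t)` -/

/-- CHM's `y(t) = (1 - |sin t|)/cos t`, written as the equal expression `cos t/(1 + |sin t|)`, which
has no removable singularity at `t = ±π/2` (there `y = 0`). [cite: ChelkakHonglerMahfouf2024, Lemma 6.2] -/
def chmY (t : ℝ) : ℝ := Real.cos t / (1 + |Real.sin t|)

/-- `1 + |sin t| > 0`. [folklore] -/
theorem one_add_abs_sin_pos (t : ℝ) : 0 < 1 + |Real.sin t| := by positivity

/-- `cos t · y(t) = 1 - |sin t|` (`cos² = (1 - |sin|)(1 + |sin|)`). [cite: ChelkakHonglerMahfouf2024, Lemma 6.2] -/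
theorem cos_mul_chmY (t : ℝ) : Real.cos t * chmY t = 1 - |Real.sin t| := by
  unfold chmY
  have h := one_add_abs_sin_pos t
  rw [mul_div_assoc', div_eq_iff h.ne']
  have h2 : |Real.sin t| ^ 2 = Real.sin t ^ 2 := sq_abs _
  nlinarith [Real.sin_sq_add_cos_sq t]

/-- `y(t) = (1 - |sin t|)/cos t` wherever `cos t ≠ 0` — CHM's expression.
[cite: ChelkakHonglerMahfouf2024, Lemma 6.2] -/
theorem chmY_eq_div {t : ℝ} (ht : Real.cos t ≠ 0) : chmY t = (1 - |Real.sin t|) / Real.cos t := by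
  rw [eq_div_iff ht, mul_comm, cos_mul_chmY]

/-- `|y(t)| ≤ 1` ("the values are uniformly bounded since `|y(t)| ≤ 1`").
[cite: ChelkakHonglerMahfouf2024, Lemma 6.2 (first bullet)] -/
theorem abs_chmY_le_one (t : ℝ) : |chmY t| ≤ 1 := by
  unfold chmY
  rw [abs_div, abs_of_pos (one_add_abs_sin_pos t), div_le_one (one_add_abs_sin_pos t)]
  exact (Real.abs_cos_le_one t).trans (le_add_of_nonneg_right (abs_nonneg _))

/-- **`y = ½ cos t (1 + y²)`**, the identity behind the harmonicity of CHM's kernel.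
[cite: ChelkakHonglerMahfouf2024, Lemma 6.2 (second bullet)] -/
theorem chmY_eq_half_cos_mul (t : ℝ) : chmY t = 1 / 2 * Real.cos t * (1 + chmY t ^ 2) := by
  have h := one_add_abs_sin_pos t
  have hc : Real.cos t ^ 2 = (1 - |Real.sin t|) * (1 + |Real.sin t|) := by
    have h2 : |Real.sin t| ^ 2 = Real.sin t ^ 2 := sq_abs _
    nlinarith [Real.sin_sq_add_cos_sq t]
  unfold chmY
  rw [div_pow, hc]
  field_simp
  ring

/-- `y` is even. [folklore] -/
theorem chmY_neg (t : ℝ) : chmY (-t) = chmY t := by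
  simp [chmY, Real.cos_neg, Real.sin_neg, abs_neg]

/-- `y` is continuous. [folklore] -/
theorem continuous_chmY : Continuous chmY := by
  unfold chmY
  exact Real.continuous_cos.div (continuous_const.add Real.continuous_sin.abs)
    fun t => (one_add_abs_sin_pos t).ne'

/-! ### The kernel -/

/-- The integrand `cos(kt) y(t)^s P_n(cos t)` of CHM's kernel. [cite: ChelkakHonglerMahfouf2024, Lemma 6.2] -/
def kerFun (n : ℕ) (k : ℤ) (s : ℕ) (t : ℝ) : ℝ :=
  Real.cos (k * t) * chmY t ^ s * (legendre n).eval (Real.cos t)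

/-- The integrand is continuous. [folklore] -/
theorem continuous_kerFun (n : ℕ) (k : ℤ) (s : ℕ) : Continuous (kerFun n k s) := by
  unfold kerFun
  exact ((Real.continuous_cos.comp (continuous_const.mul continuous_id)).mul
    (continuous_chmY.pow s)).mul ((legendre n).continuous.comp Real.continuous_cos)

/-- The integrand is interval integrable. [folklore] -/
theorem intervalIntegrable_kerFun (n : ℕ) (k : ℤ) (s : ℕ) (a b : ℝ) :
    IntervalIntegrable (kerFun n k s) volume a b :=
  (continuous_kerFun n k s).intervalIntegrable a b

/-- **CHM's explicit kernel** (real form, without the normalising constant `C_n`):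
`K_n(k, s) = (1/2π) ∫_{-π}^{π} cos(kt) y(t)^s P_n(cos t) dt` (`= (1/2π)∫ e^{-ikt} y^s P_n(cos t) dt`,
whose imaginary part vanishes by parity). CHM's spinor is `V(k, ±s) = C_n K_n(k, s)` on the sublattice
`n + k + s ∈ 2ℤ`. [cite: ChelkakHonglerMahfouf2024, Lemma 6.2, eq. for V(k,±s)] -/
def legendreKernel (n : ℕ) (k : ℤ) (s : ℕ) : ℝ :=
  1 / (2 * π) * ∫ t in (-π)..π, kerFun n k s t

/-- The kernel is even in `k`. [folklore] -/
theorem legendreKernel_neg (n : ℕ) (k : ℤ) (s : ℕ) : legendreKernel n (-k) s = legendreKernel n k s := by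
  unfold legendreKernel
  congr 1
  refine intervalIntegral.integral_congr fun t _ => ?_
  simp [kerFun, Real.cos_neg, neg_mul]

/-- The real form is no loss: the sine part of `(1/2π)∫ e^{-ikt} y^s P_n(cos t) dt` vanishes, its
integrand `sin(kt) y(t)^s P_n(cos t)` being odd. [folklore] -/
theorem integral_sin_mul_eq_zero (n : ℕ) (k : ℤ) (s : ℕ) :
    ∫ t in (-π)..π, Real.sin (k * t) * chmY t ^ s * (legendre n).eval (Real.cos t) = 0 := by
  set g : ℝ → ℝ := fun t => Real.sin (k * t) * chmY t ^ s * (legendre n).eval (Real.cos t) with hg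
  have hodd : ∀ t, g (-t) = -g t := by
    intro t; simp [hg, mul_neg, Real.sin_neg, Real.cos_neg, chmY_neg]
  have h := intervalIntegral.integral_comp_neg (a := -π) (b := π) (f := g)
  rw [neg_neg] at h
  have h2 : ∫ t in (-π)..π, g (-t) = -∫ t in (-π)..π, g t := by
    rw [← intervalIntegral.integral_neg]
    exact intervalIntegral.integral_congr fun t _ => hodd t
  change ∫ t in (-π)..π, g t = 0
  linarith [h.symm.trans h2]

/-- **Boundedness** (CHM Lemma 6.2, first bullet): `|K_n(k,s)| ≤ (1/2π) ∫_{-π}^{π} |P_n(cos t)| dt`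
uniformly in `k` and `s`, since `|cos(kt)| ≤ 1` and `|y| ≤ 1`. [cite: ChelkakHonglerMahfouf2024, Lemma 6.2 (first bullet)] -/
theorem abs_legendreKernel_le (n : ℕ) (k : ℤ) (s : ℕ) :
    |legendreKernel n k s| ≤ 1 / (2 * π) * ∫ t in (-π)..π, |(legendre n).eval (Real.cos t)| := by
  unfold legendreKernel
  rw [abs_mul, abs_of_pos (by positivity : (0 : ℝ) < 1 / (2 * π))]
  refine mul_le_mul_of_nonneg_left ?_ (by positivity)
  have hπ : -π ≤ π := by linarith [Real.pi_pos]
  refine (abs_integral_le_integral_abs hπ).trans (intervalIntegral.integral_mono_on hπ ?_ ?_ ?_)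
  · exact ((continuous_kerFun n k s).abs).intervalIntegrable _ _
  · exact (((legendre n).continuous.comp Real.continuous_cos).abs).intervalIntegrable _ _
  · intro t _
    simp only [kerFun]
    rw [abs_mul, abs_mul]
    have h1 : |Real.cos (k * t)| ≤ 1 := Real.abs_cos_le_one _
    have h2 : |chmY t ^ s| ≤ 1 := by
      rw [abs_pow]; exact pow_le_one₀ (abs_nonneg _) (abs_chmY_le_one t)
    have h3 : 0 ≤ |(legendre n).eval (Real.cos t)| := abs_nonneg _
    calc |Real.cos (k * t)| * |chmY t ^ s| * |(legendre n).eval (Real.cos t)|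
        ≤ 1 * 1 * |(legendre n).eval (Real.cos t)| := by gcongr
      _ = _ := by ring

/-! ### Harmonicity off the real line (CHM Lemma 6.2, second bullet) -/

/-- `cos((k-1)t) + cos((k+1)t) = 2 cos(kt) cos t`. [folklore] -/
theorem cos_sub_one_add_cos_add_one (k : ℤ) (t : ℝ) :
    Real.cos (((k - 1 : ℤ) : ℝ) * t) + Real.cos (((k + 1 : ℤ) : ℝ) * t) =
      2 * Real.cos (k * t) * Real.cos t := by
  push_cast
  rw [sub_mul, add_mul, one_mul, Real.cos_sub, Real.cos_add]
  ring

/-- **Discrete harmonicity for `s ≥ 1`**: `K(k,s) = ¼[K(k-1,s-1) + K(k+1,s-1) + K(k-1,s+1) + K(k+1,s+1)]`,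
because `¼(e^{it} + e^{-it})(y^{s-1} + y^{s+1}) = ½ cos t · y^{s-1}(1 + y²) = y^s`.
[cite: ChelkakHonglerMahfouf2024, Lemma 6.2 (second bullet)] -/
theorem legendreKernel_harmonic (n : ℕ) (k : ℤ) {s : ℕ} (hs : 1 ≤ s) :
    legendreKernel n k s = 1 / 4 * (legendreKernel n (k - 1) (s - 1) + legendreKernel n (k + 1) (s - 1) +
      legendreKernel n (k - 1) (s + 1) + legendreKernel n (k + 1) (s + 1)) := by
  obtain ⟨r, rfl⟩ : ∃ r, s = r + 1 := ⟨s - 1, by omega⟩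
  simp only [Nat.add_sub_cancel]
  have hpt : ∀ t, kerFun n k (r + 1) t = 1 / 4 * (kerFun n (k - 1) r t + kerFun n (k + 1) r t +
      kerFun n (k - 1) (r + 1 + 1) t + kerFun n (k + 1) (r + 1 + 1) t) := by
    intro t
    simp only [kerFun]
    have hy := chmY_eq_half_cos_mul t
    have hc := cos_sub_one_add_cos_add_one k t
    have key : chmY t ^ (r + 1) = chmY t ^ r * (1 / 2 * Real.cos t * (1 + chmY t ^ 2)) := by
      rw [pow_succ, ← hy]
    have hgrp : (1 : ℝ) / 4 * (Real.cos (((k - 1 : ℤ) : ℝ) * t) * chmY t ^ r * (legendre n).eval (Real.cos t) +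
        Real.cos (((k + 1 : ℤ) : ℝ) * t) * chmY t ^ r * (legendre n).eval (Real.cos t) +
        Real.cos (((k - 1 : ℤ) : ℝ) * t) * chmY t ^ (r + 1 + 1) * (legendre n).eval (Real.cos t) +
        Real.cos (((k + 1 : ℤ) : ℝ) * t) * chmY t ^ (r + 1 + 1) * (legendre n).eval (Real.cos t)) =
        1 / 4 * ((Real.cos (((k - 1 : ℤ) : ℝ) * t) + Real.cos (((k + 1 : ℤ) : ℝ) * t)) *
          (chmY t ^ r * (1 + chmY t ^ 2)) * (legendre n).eval (Real.cos t)) := by ring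
    rw [hgrp, hc, key]; ring
  have hI := intervalIntegrable_kerFun
  unfold legendreKernel
  rw [intervalIntegral.integral_congr fun t _ => hpt t, intervalIntegral.integral_const_mul,
    intervalIntegral.integral_add (((hI n (k - 1) r _ _).add (hI n (k + 1) r _ _)).add
      (hI n (k - 1) (r + 1 + 1) _ _)) (hI n (k + 1) (r + 1 + 1) _ _),
    intervalIntegral.integral_add ((hI n (k - 1) r _ _).add (hI n (k + 1) r _ _))
      (hI n (k - 1) (r + 1 + 1) _ _),
    intervalIntegral.integral_add (hI n (k - 1) r _ _) (hI n (k + 1) r _ _)]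
  ring

/-! ### The real line: `-[ΔV](k,0)` as a Chebyshev–Legendre pairing -/

/-- `cos(kt)(1 - cos t · y) = cos(kt)|sin t|`: the row identity
`K(k,0) - ½[K(k-1,1) + K(k+1,1)] = (1/2π) ∫ cos(kt) |sin t| P_n(cos t) dt`.
[cite: ChelkakHonglerMahfouf2024, Lemma 6.2 (displayed computation)] -/
theorem legendreKernel_row_eq_integral_abs_sin (n : ℕ) (k : ℤ) :
    legendreKernel n k 0 - 1 / 2 * (legendreKernel n (k - 1) 1 + legendreKernel n (k + 1) 1) =
      1 / (2 * π) * ∫ t in (-π)..π, Real.cos (k * t) * |Real.sin t| * (legendre n).eval (Real.cos t) := by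
  have hpt : ∀ t, Real.cos (k * t) * |Real.sin t| * (legendre n).eval (Real.cos t) =
      kerFun n k 0 t - 1 / 2 * (kerFun n (k - 1) 1 t + kerFun n (k + 1) 1 t) := by
    intro t
    simp only [kerFun, pow_zero, pow_one, mul_one]
    have hc := cos_sub_one_add_cos_add_one k t
    have hy := cos_mul_chmY t
    have hgrp : Real.cos (((k - 1 : ℤ) : ℝ) * t) * chmY t * (legendre n).eval (Real.cos t) +
        Real.cos (((k + 1 : ℤ) : ℝ) * t) * chmY t * (legendre n).eval (Real.cos t) =
        (Real.cos (((k - 1 : ℤ) : ℝ) * t) + Real.cos (((k + 1 : ℤ) : ℝ) * t)) * chmY t *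
          (legendre n).eval (Real.cos t) := by ring
    rw [hgrp, hc]
    have h2 : 2 * Real.cos (k * t) * Real.cos t * chmY t = 2 * Real.cos (k * t) * (1 - |Real.sin t|) := by
      rw [← hy]; ring
    rw [h2]; ring
  have hI := intervalIntegrable_kerFun
  unfold legendreKernel
  rw [intervalIntegral.integral_congr fun t _ => hpt t,
    intervalIntegral.integral_sub (hI n k 0 _ _) (((hI n (k - 1) 1 _ _).add (hI n (k + 1) 1 _ _)).const_mul _),
    intervalIntegral.integral_const_mul, intervalIntegral.integral_add (hI n (k - 1) 1 _ _) (hI n (k + 1) 1 _ _)]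
  ring

/-- Evenness: `∫_{-π}^{π} cos(kt)|sin t| P_n(cos t) dt = 2 ∫_0^{π} cos(kt) sin t P_n(cos t) dt`. [folklore] -/
theorem integral_cos_abs_sin_legendre (n : ℕ) (k : ℤ) :
    ∫ t in (-π)..π, Real.cos (k * t) * |Real.sin t| * (legendre n).eval (Real.cos t) =
      2 * ∫ t in (0 : ℝ)..π, Real.cos (k * t) * Real.sin t * (legendre n).eval (Real.cos t) := by
  set f : ℝ → ℝ := fun t => Real.cos (k * t) * |Real.sin t| * (legendre n).eval (Real.cos t) with hf
  have hfc : Continuous f := ((Real.continuous_cos.comp (continuous_const.mul continuous_id)).mul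
    Real.continuous_sin.abs).mul ((legendre n).continuous.comp Real.continuous_cos)
  have heven : ∀ t, f (-t) = f t := by
    intro t; simp [hf, Real.cos_neg, Real.sin_neg, abs_neg]
  have hsplit : ∫ t in (-π)..π, f t = (∫ t in (-π)..0, f t) + ∫ t in (0 : ℝ)..π, f t :=
    (intervalIntegral.integral_add_adjacent_intervals (hfc.intervalIntegrable _ _)
      (hfc.intervalIntegrable _ _)).symm
  have hneg : ∫ t in (-π)..0, f t = ∫ t in (0 : ℝ)..π, f t := by
    have h := intervalIntegral.integral_comp_neg (a := 0) (b := π) (f := f)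
    simp only [neg_zero] at h
    rw [← h]
    exact intervalIntegral.integral_congr fun t _ => heven t
  have hpos : ∫ t in (0 : ℝ)..π, f t =
      ∫ t in (0 : ℝ)..π, Real.cos (k * t) * Real.sin t * (legendre n).eval (Real.cos t) := by
    refine intervalIntegral.integral_congr fun t ht => ?_
    rw [Set.uIcc_of_le Real.pi_pos.le] at ht
    simp only [hf]
    rw [abs_of_nonneg (Real.sin_nonneg_of_nonneg_of_le_pi ht.1 ht.2)]
  change ∫ t in (-π)..π, f t = _
  rw [hsplit, hneg, hpos]; ring

/-- Substitution `x = cos t`: `∫_0^{π} cos(kt) sin t P_n(cos t) dt = ∫_{-1}^1 T_k(x) P_n(x) dx`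
(`cos(kt) = T_k(cos t)`). [folklore] -/
theorem integral_cos_sin_legendre_eq (n : ℕ) (k : ℤ) :
    ∫ t in (0 : ℝ)..π, Real.cos (k * t) * Real.sin t * (legendre n).eval (Real.cos t) =
      ∫ x in (-1 : ℝ)..1, (Chebyshev.T ℝ k).eval x * (legendre n).eval x := by
  have h : ∫ t in (0 : ℝ)..π, ((fun x : ℝ => (Chebyshev.T ℝ k).eval x * (legendre n).eval x) ∘ Real.cos) t
      * (-Real.sin t) = ∫ x in (Real.cos 0)..(Real.cos π),
        (Chebyshev.T ℝ k).eval x * (legendre n).eval x :=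
    integral_comp_mul_deriv (f' := fun x => -Real.sin x) (fun x _ => Real.hasDerivAt_cos x)
      (Real.continuous_sin.neg.continuousOn)
      ((Chebyshev.T ℝ k).continuous.mul (legendre n).continuous)
  rw [Real.cos_zero, Real.cos_pi, intervalIntegral.integral_symm (-1 : ℝ) 1] at h
  rw [← neg_neg (∫ x in (-1 : ℝ)..1, _), ← h, ← intervalIntegral.integral_neg]
  refine intervalIntegral.integral_congr fun t _ => ?_
  simp only [Function.comp_apply, Polynomial.Chebyshev.T_real_cos]
  ring

/-- **The row identity of CHM Lemma 6.2**:
`K(k,0) - ½[K(k-1,1) + K(k+1,1)] = (1/π) ∫_{-1}^1 T_k(x) P_n(x) dx` ("`-[ΔV](k,0) = (C_n/π)∫T_{|k|}P_n`";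
`T_{-k} = T_k`). [cite: ChelkakHonglerMahfouf2024, Lemma 6.2 (displayed computation)] -/
theorem legendreKernel_row (n : ℕ) (k : ℤ) :
    legendreKernel n k 0 - 1 / 2 * (legendreKernel n (k - 1) 1 + legendreKernel n (k + 1) 1) =
      1 / π * ∫ x in (-1 : ℝ)..1, (Chebyshev.T ℝ k).eval x * (legendre n).eval x := by
  rw [legendreKernel_row_eq_integral_abs_sin, integral_cos_abs_sin_legendre, integral_cos_sin_legendre_eq]
  have hπ : π ≠ 0 := Real.pi_ne_zero
  field_simp

/-- Hence `-[ΔV](k,0) = 0` for `|k| < n` (orthogonality of `P_n` to `T_{|k|}`).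
[cite: ChelkakHonglerMahfouf2024, Lemma 6.2 (displayed computation, "= 0 for all |k| < n")] -/
theorem legendreKernel_row_eq_zero (n : ℕ) {k : ℤ} (hk : k.natAbs < n) :
    legendreKernel n k 0 - 1 / 2 * (legendreKernel n (k - 1) 1 + legendreKernel n (k + 1) 1) = 0 := by
  rw [legendreKernel_row, ← Polynomial.Chebyshev.T_natAbs,
    integral_chebyshevT_mul_legendre_eq_zero hk, mul_zero]

/-- And at the branchings `k = ±n`:
`K(n,0) - ½[K(n-1,1) + K(n+1,1)] = (1/π) · (2^{n-1}/p_n) · 2/(2n+1)` ("`= 2C_n t_n/(π(2n+1)p_n)`").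
[cite: ChelkakHonglerMahfouf2024, proof of Thm. 6.3] -/
theorem legendreKernel_row_self (n : ℕ) :
    legendreKernel n n 0 - 1 / 2 * (legendreKernel n (n - 1) 1 + legendreKernel n (n + 1) 1) =
      1 / π * ((2 : ℝ) ^ (n - 1) / legendreLead n * (2 / (2 * n + 1))) := by
  rw [legendreKernel_row]
  congr 1
  exact_mod_cast integral_chebyshevT_mul_legendre n

/-! ### The real line: the values `K(k, 0)` (CHM Lemma 6.2, third bullet, and `D_n = C_n 2^{-n} p_n`) -/

/-- The Fourier coefficients of the powers of the cosine,
`I(k, m) = (1/2π) ∫_{-π}^{π} cos(kt) cos^m t dt`. [folklore] -/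
def cosPowCoeff (k : ℤ) (m : ℕ) : ℝ :=
  1 / (2 * π) * ∫ t in (-π)..π, Real.cos (k * t) * Real.cos t ^ m

/-- `∫_{-π}^{π} cos(kt) dt = 0` for `k ≠ 0`. [folklore] -/
theorem integral_cos_int_mul {k : ℤ} (hk : k ≠ 0) : ∫ t in (-π)..π, Real.cos (k * t) = 0 := by
  have hk' : (k : ℝ) ≠ 0 := by exact_mod_cast hk
  rw [intervalIntegral.integral_comp_mul_left (fun t => Real.cos t) hk', integral_cos]
  have h1 : Real.sin ((k : ℝ) * π) = 0 := Real.sin_int_mul_pi k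
  have h2 : Real.sin ((k : ℝ) * -π) = 0 := by
    rw [mul_neg, Real.sin_neg, h1, neg_zero]
  rw [h1, h2]; simp

/-- `I(k, 0) = [k = 0]`. [folklore] -/
theorem cosPowCoeff_zero (k : ℤ) : cosPowCoeff k 0 = if k = 0 then 1 else 0 := by
  unfold cosPowCoeff
  simp only [pow_zero, mul_one]
  split_ifs with hk
  · subst hk
    simp only [Int.cast_zero, zero_mul, Real.cos_zero]
    rw [intervalIntegral.integral_const]
    have hπ : π ≠ 0 := Real.pi_ne_zero
    simp only [smul_eq_mul, mul_one]
    field_simp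
    ring
  · rw [integral_cos_int_mul hk, mul_zero]

/-- The recursion `I(k, m+1) = ½[I(k+1, m) + I(k-1, m)]` (`cos t cos(kt) = ½[cos((k+1)t) + cos((k-1)t)]`).
[folklore] -/
theorem cosPowCoeff_succ (k : ℤ) (m : ℕ) :
    cosPowCoeff k (m + 1) = 1 / 2 * (cosPowCoeff (k + 1) m + cosPowCoeff (k - 1) m) := by
  have hI : ∀ (k' : ℤ) (m' : ℕ), IntervalIntegrable (fun t : ℝ => Real.cos (k' * t) * Real.cos t ^ m')
      volume (-π) π := fun k' m' => Continuous.intervalIntegrable (by fun_prop) _ _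
  have hpt : ∀ t : ℝ, Real.cos (k * t) * Real.cos t ^ (m + 1) =
      1 / 2 * (Real.cos (((k + 1 : ℤ) : ℝ) * t) * Real.cos t ^ m +
        Real.cos (((k - 1 : ℤ) : ℝ) * t) * Real.cos t ^ m) := by
    intro t
    have hc := cos_sub_one_add_cos_add_one k t
    rw [pow_succ, show Real.cos (((k + 1 : ℤ) : ℝ) * t) * Real.cos t ^ m +
        Real.cos (((k - 1 : ℤ) : ℝ) * t) * Real.cos t ^ m =
        (Real.cos (((k - 1 : ℤ) : ℝ) * t) + Real.cos (((k + 1 : ℤ) : ℝ) * t)) * Real.cos t ^ m by ring, hc]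
    ring
  unfold cosPowCoeff
  rw [intervalIntegral.integral_congr fun t _ => hpt t, intervalIntegral.integral_const_mul,
    intervalIntegral.integral_add (hI _ _) (hI _ _)]
  ring

/-- `I(k, m) = 0` for `|k| > m`. [folklore] -/
theorem cosPowCoeff_eq_zero_of_lt {m : ℕ} {k : ℤ} (hk : m < k.natAbs) : cosPowCoeff k m = 0 := by
  induction m generalizing k with
  | zero =>
    rw [cosPowCoeff_zero, if_neg]
    rintro rfl; simp at hk
  | succ m ih =>
    rw [cosPowCoeff_succ, ih (by omega), ih (by omega)]; ring

/-- `I(m, m) = 2^{-m}` (the top Fourier coefficient of `cos^m t = 2^{-m}(e^{it} + e^{-it})^m`). [folklore] -/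
theorem cosPowCoeff_self (m : ℕ) : cosPowCoeff m m = 1 / 2 ^ m := by
  induction m with
  | zero => rw [Nat.cast_zero, cosPowCoeff_zero, if_pos rfl, pow_zero, div_one]
  | succ m ih =>
    rw [Nat.cast_succ, cosPowCoeff_succ, add_sub_cancel_right, ih,
      cosPowCoeff_eq_zero_of_lt (k := (m : ℤ) + 1 + 1) (by omega), zero_add, pow_succ]
    field_simp

/-- The Fourier coefficients of `q(cos t)` for a polynomial `q` of degree `≤ n`:
`(1/2π) ∫ cos(kt) q(cos t) dt = ∑_{m ≤ n} (coeff m q) I(k, m)`. [folklore] -/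
theorem fourierCoeff_eval_cos {q : ℝ[X]} {n : ℕ} (hq : q.natDegree ≤ n) (k : ℤ) :
    1 / (2 * π) * ∫ t in (-π)..π, Real.cos (k * t) * q.eval (Real.cos t) =
      ∑ m ∈ range (n + 1), q.coeff m * cosPowCoeff k m := by
  have hexp : ∀ t : ℝ, Real.cos (k * t) * q.eval (Real.cos t) =
      ∑ m ∈ range (n + 1), q.coeff m * (Real.cos (k * t) * Real.cos t ^ m) := by
    intro t
    rw [eval_eq_sum_range' (Nat.lt_succ_of_le hq), Finset.mul_sum]
    refine Finset.sum_congr rfl fun m _ => ?_; ring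
  have hI : ∀ m ∈ range (n + 1), IntervalIntegrable
      (fun t : ℝ => q.coeff m * (Real.cos (k * t) * Real.cos t ^ m)) volume (-π) π :=
    fun m _ => Continuous.intervalIntegrable (by fun_prop) _ _
  rw [intervalIntegral.integral_congr fun t _ => hexp t, intervalIntegral.integral_finsetSum hI,
    Finset.mul_sum]
  refine Finset.sum_congr rfl fun m _ => ?_
  rw [intervalIntegral.integral_const_mul, cosPowCoeff]; ring

/-- On the real line the kernel is a Fourier coefficient of `P_n(cos t)`. [folklore] -/
theorem legendreKernel_zero_eq (n : ℕ) (k : ℤ) :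
    legendreKernel n k 0 = 1 / (2 * π) * ∫ t in (-π)..π, Real.cos (k * t) * (legendre n).eval (Real.cos t) := by
  unfold legendreKernel
  congr 1
  refine intervalIntegral.integral_congr fun t _ => ?_
  simp [kerFun]

/-- **`K(k, 0) = 0` for `|k| > n`** (CHM Lemma 6.2, third bullet: the spinor vanishes on the real line
outside the segment `[𝐯, 𝐮]`). [cite: ChelkakHonglerMahfouf2024, Lemma 6.2 (third bullet)] -/
theorem legendreKernel_zero_of_lt (n : ℕ) {k : ℤ} (hk : n < k.natAbs) : legendreKernel n k 0 = 0 := by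
  rw [legendreKernel_zero_eq, fourierCoeff_eval_cos (natDegree_legendre_le n)]
  refine Finset.sum_eq_zero fun m hm => ?_
  rw [cosPowCoeff_eq_zero_of_lt (by have := Finset.mem_range.1 hm; omega), mul_zero]

/-- **`K(±n, 0) = 2^{-n} p_n`** ("it follows from the explicit formula that `D_n = C_n · 2^{-n} p_n`").
[cite: ChelkakHonglerMahfouf2024, proof of Thm. 6.3] -/
theorem legendreKernel_self (n : ℕ) : legendreKernel n n 0 = legendreLead n / 2 ^ n := by
  rw [legendreKernel_zero_eq, fourierCoeff_eval_cos (natDegree_legendre_le n), Finset.sum_range_succ,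
    Finset.sum_eq_zero fun m hm => ?_, zero_add, coeff_legendre_self, cosPowCoeff_self]
  · ring
  · rw [cosPowCoeff_eq_zero_of_lt (by have := Finset.mem_range.1 hm; simp; omega), mul_zero]

/-! ### Assembly: CHM Theorem 6.3 from the boundary relations (6.1)–(6.2) -/

/-- **CHM's derivation of Wu's recurrence.** Let `D : ℕ → ℝ` and constants `C : ℕ → ℝ` be such that
the spinors `V_n := C_n · K_n` satisfy CHM's boundary relations at the branchings:
(6.1) `V_n(n, 0) = D_n`, and (6.2) `-[ΔV_n](n, 0) = ½ D_{n+1}` for `n ≥ 1`, `-[ΔV_0](0,0) = D_1`, where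
`-[ΔV](k,0) = V(k,0) - ½[V(k-1,1) + V(k+1,1)]`. Then `D_{n+1} = ρ_n D_n` with
`ρ_n = 2^{2n+1}/(π(2n+1)p_n²) = wuRatio n` — the recurrence
`D_{n+1}/D_n = 2^{n+1}C_n/(π(2n+1)p_n) = 2^{2n+1}/(π(2n+1)p_n²)` of the proof of CHM Thm 6.3.
(In CHM, `V_n` is the Kadanoff–Ceva spinor, equal to `C_n K_n` by uniqueness of bounded harmonic
spinors; (6.1)–(6.2) are its values near the branchings. Those inputs are hypotheses here.)
[cite: ChelkakHonglerMahfouf2024, Thm. 6.3 (proof)] -/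
theorem chm_wu_recurrence {D C : ℕ → ℝ}
    (hval : ∀ n, C n * legendreKernel n n 0 = D n)
    (hlap0 : C 0 * (legendreKernel 0 0 0 - 1 / 2 * (legendreKernel 0 (0 - 1) 1 + legendreKernel 0 (0 + 1) 1)) = D 1)
    (hlap : ∀ n : ℕ, 1 ≤ n → C n * (legendreKernel n n 0 -
      1 / 2 * (legendreKernel n (n - 1) 1 + legendreKernel n (n + 1) 1)) = 1 / 2 * D (n + 1)) :
    ∀ n, D (n + 1) = D n * wuRatio n := by
  intro n
  have hp : 0 < legendreLead n := legendreLead_pos n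
  have hπ : 0 < π := Real.pi_pos
  -- `C_n = D_n 2^n / p_n`
  have hC : C n = D n * 2 ^ n / legendreLead n := by
    have h := hval n
    rw [legendreKernel_self] at h
    rw [eq_div_iff hp.ne', ← h]
    field_simp
  rw [wuRatio_eq_legendreLead]
  rcases Nat.eq_zero_or_pos n with rfl | hn
  · -- `n = 0`: `D_1 = C_0 · (2/π)`, `C_0 = D_0`
    have h := hlap0
    have hrow := legendreKernel_row_self 0
    simp only [Nat.cast_zero] at hrow
    rw [hrow] at h
    have hL : legendreLead 0 = 1 := by norm_num [legendreLead]
    have hπ' : π ≠ 0 := hπ.ne'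
    have e1 : D (0 + 1) = D 0 * (2 / π) := by
      rw [zero_add, ← h, hC, hL, show (0 : ℕ) - 1 = 0 from rfl, pow_zero]
      field_simp
      ring
    have e2 : (2 : ℝ) ^ (2 * 0 + 1) / (π * (2 * ((0 : ℕ) : ℝ) + 1) *
        (((2 * 0)! : ℝ) / (2 ^ 0 * ((0 ! : ℕ) : ℝ) ^ 2)) ^ 2) = 2 / π := by
      norm_num
    rw [e1, e2]
  · have h := hlap n hn
    rw [legendreKernel_row_self n, hC] at h
    have h2 : D (n + 1) = 2 * (D n * 2 ^ n / legendreLead n *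
        (1 / π * ((2 : ℝ) ^ (n - 1) / legendreLead n * (2 / (2 * n + 1))))) := by linarith
    rw [h2]
    obtain ⟨m, rfl⟩ : ∃ m, n = m + 1 := ⟨n - 1, by omega⟩
    simp only [Nat.add_sub_cancel]
    unfold legendreLead
    have h3 : (2 * ((m + 1 : ℕ) : ℝ) + 1) ≠ 0 := by positivity
    have h4 : ((2 * (m + 1))! : ℝ) ≠ 0 := by positivity
    have h5 : (((m + 1)! : ℕ) : ℝ) ≠ 0 := by positivity
    push_cast
    field_simp
    ring

/-- **CHM Theorem 6.3 (Wu's formula), conditional form.** Under the hypotheses of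
`chm_wu_recurrence` and `D_0 = 1`, `D_n = (2/π)^n ∏_{l=1}^{n-1}(1 - 1/(4l²))^{l-n} = wuDiag n`.
[cite: ChelkakHonglerMahfouf2024, Thm. 6.3] -/
theorem chm_wu_formula {D C : ℕ → ℝ} (h0 : D 0 = 1)
    (hval : ∀ n, C n * legendreKernel n n 0 = D n)
    (hlap0 : C 0 * (legendreKernel 0 0 0 - 1 / 2 * (legendreKernel 0 (0 - 1) 1 + legendreKernel 0 (0 + 1) 1)) = D 1)
    (hlap : ∀ n : ℕ, 1 ≤ n → C n * (legendreKernel n n 0 -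
      1 / 2 * (legendreKernel n (n - 1) 1 + legendreKernel n (n + 1) 1)) = 1 / 2 * D (n + 1)) :
    ∀ n, D n = wuDiag n :=
  eq_wuDiag_of_wuRatio h0 (chm_wu_recurrence hval hlap0 hlap)

end Literature.Probability.LatticeModels
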